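import Literature.MathematicalPhysics.QuantumLattice.LindhardSRepresentation
import Literature.MathematicalPhysics.QuantumLattice.AnisotropicBandDOSEllipticK
import HarnessLib

/-!
# The square-lattice Lindhard function as an explicit one-dimensional integral of complete
# elliptic integrals (CERT-SREP Prop. 2 with the closed form (1.1))

Topic `Literature/MathematicalPhysics/QuantumLattice`. Composition of the tree's pointwise
`s`-representation (`lindhardFunction_squareDispersion_eq_sRepresentation`, t2: for `-4 < μ < 0` and
`q ∉ 2πℤ²`, `χ₀(q; μ) = (2π)⁻² ∫₀¹ σ_s(ℝ²) ds` with `σ_s` the density-of-states measure of the band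
`-2(A₀(s) cos k₀ + A₁(s) cos k₁)`, `A_i(s) = √(1 - 4s(1-s) sin²(q_i/2))`) with the closed form of
`σ_{a,b,μ}(ℝ²)` (`AnisotropicBandDOSEllipticK.lean`: `8K(16ab/P)/√P` inside the van Hove energy,
`2K(P/16ab)/√(ab)` between van Hove energy and band edge, `0` outside; `P = 4(a+b)² - μ²`,
`K = ellipticK`, parameter convention). The finitely many exceptional parameters `s` (van Hove
levels — t2's `finite_setOf_vanHove` —, band-edge coincidences and `A_i(s) = 0`) form a null set, so:

* `anisoDOSMass μ a b` — the piecewise closed form (a definition; CERT-SREP (1.1) times `(2π)²`);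
* `fermiCurveMeasure_anisoBand_univ_toReal` — `(σ_{a,b,μ}(ℝ²)).toReal = anisoDOSMass μ a b` for
  `a, b > 0` off the two exceptional levels;
* `lindhardFunction_squareDispersion_eq_integral_anisoDOSMass` — **`χ₀(q; μ) = (2π)⁻² ∫₀¹ anisoDOSMass μ (A₀(s)) (A₁(s)) ds`**
  for `-4 < μ < 0`, `q ∉ 2πℤ²`: the T = 0 Lindhard function of the square lattice is an explicit
  one-dimensional integral of complete elliptic integrals (the object a verified quadrature evaluates,
  Kohn–Luttinger certificate programme of stmt-0158 / stmt-1741).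

## References
* [RaghuKivelsonScalapino2010] S. Raghu, S. A. Kivelson, D. J. Scalapino, Phys. Rev. B 81 (2010) 224505, §II (5)–(6).
* [GradshteynRyzhik2015] Gradshteyn–Ryzhik, 8th ed., 3.147.4 (the reduction behind the closed form).
-/

noncomputable section

open Real _root_.MeasureTheory _root_.Set
open Literature.Probability.RandomPlanarGeometry

namespace Literature.MathematicalPhysics.QuantumLattice

/-- **The closed form of the density-of-states mass** `σ_{a,b,μ}(ℝ²) = (2π)² ρ(μ; a, b)` of the band
`-2(a cos k₀ + b cos k₁)` (CERT-SREP (1.1) × (2π)²): `8K(16ab/P)/√P` for `|μ| < 2|a-b|`,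
`2K(P/(16ab))/√(ab)` for `2|a-b| ≤ |μ| < 2(a+b)`, `0` for `|μ| ≥ 2(a+b)`, `P = 4(a+b)² - μ²`
(the values AT the two exceptional levels are conventions). [cite: RaghuKivelsonScalapino2010, §II (6)] -/
def anisoDOSMass (μ a b : ℝ) : ℝ :=
  if |μ| < 2 * |a - b| then
    8 * ellipticK (16 * a * b / (4 * (a + b) ^ 2 - μ ^ 2)) / Real.sqrt (4 * (a + b) ^ 2 - μ ^ 2)
  else if |μ| < 2 * (a + b) then
    2 * ellipticK ((4 * (a + b) ^ 2 - μ ^ 2) / (16 * a * b)) / Real.sqrt (a * b)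
  else 0

variable {a b μ : ℝ}

/-- `(σ_{a,b,μ}(ℝ²)).toReal = anisoDOSMass μ a b` for `a, b > 0` off the van Hove level `2|a-b|` and the
band edge `2(a+b)`. [cite: RaghuKivelsonScalapino2010, §II (6)] -/
theorem fermiCurveMeasure_anisoBand_univ_toReal (ha : 0 < a) (hb : 0 < b) (h₁ : |μ| ≠ 2 * |a - b|)
    (h₂ : |μ| ≠ 2 * (a + b)) :
    (fermiCurveMeasure (fun k : Momentum => -2 * (a * Real.cos (k 0) + b * Real.cos (k 1))) μ univ).toReal =
      anisoDOSMass μ a b := by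
  unfold anisoDOSMass
  by_cases hin : |μ| < 2 * |a - b|
  · rw [if_pos hin, fermiCurveMeasure_anisoBand_univ_inner ha hb hin,
      ENNReal.toReal_ofReal (div_nonneg (mul_nonneg (by norm_num) (ellipticK_nonneg _)) (Real.sqrt_nonneg _))]
  · rw [if_neg hin]
    have hge : 2 * |a - b| < |μ| := lt_of_le_of_ne (not_lt.1 hin) (Ne.symm h₁)
    by_cases hout : |μ| < 2 * (a + b)
    · rw [if_pos hout, fermiCurveMeasure_anisoBand_univ_outer ha hb hge hout,
        ENNReal.toReal_ofReal (div_nonneg (mul_nonneg (by norm_num) (ellipticK_nonneg _)) (Real.sqrt_nonneg _))]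
    · rw [if_neg hout, fermiCurveMeasure_anisoBand_univ_out ha hb (lt_of_le_of_ne (not_lt.1 hout) (Ne.symm h₂)),
        ENNReal.toReal_zero]

/-- The parameters `s` at which an amplitude `A_i(s) = √(1 - 4s(1-s)S)` vanishes form a finite set
(roots of a non-zero quadratic). [cite: RaghuKivelsonScalapino2010, §II (5)] -/
theorem finite_setOf_amplitude_zero (S : ℝ) : Set.Finite {s : ℝ | 1 - 4 * s * (1 - s) * S = 0} := by
  set P : Polynomial ℝ := 1 - Polynomial.C (4 * S) * Polynomial.X * (1 - Polynomial.X) with hP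
  have hPe : ∀ s : ℝ, P.eval s = 1 - 4 * s * (1 - s) * S := by
    intro s
    simp only [hP, Polynomial.eval_sub, Polynomial.eval_mul, Polynomial.eval_C, Polynomial.eval_X,
      Polynomial.eval_one]
    ring
  have hP0 : P ≠ 0 := by
    intro h; have := hPe 0; rw [h, Polynomial.eval_zero] at this; norm_num at this
  refine (Polynomial.finite_setOf_isRoot hP0).subset fun s hs => ?_
  simp only [mem_setOf_eq, Polynomial.IsRoot.def, hPe]
  exact hs

/-- The band-edge coincidences `c = A₀(s) + A₁(s)` (`0 < c < 2`) form a finite subset of `[0,1]`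
(squaring twice: roots of a quartic whose value at `s = 0` is `c²(4 - c²) ≠ 0`).
[cite: RaghuKivelsonScalapino2010, §II (5)] -/
theorem finite_setOf_bandEdge (c S₀ S₁ : ℝ) (hc0 : 0 < c) (hc2 : c < 2)
    (hS₀ : 0 ≤ S₀) (hS₀' : S₀ ≤ 1) (hS₁ : 0 ≤ S₁) (hS₁' : S₁ ≤ 1) :
    Set.Finite {s : ℝ | s ∈ Icc (0 : ℝ) 1 ∧
      c = Real.sqrt (1 - 4 * s * (1 - s) * S₀) + Real.sqrt (1 - 4 * s * (1 - s) * S₁)} := by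
  set Q : Polynomial ℝ :=
    Polynomial.C (4 * c ^ 2) * (1 - Polynomial.C (4 * S₀) * Polynomial.X * (1 - Polynomial.X)) -
      (Polynomial.C (c ^ 2) + (1 - Polynomial.C (4 * S₀) * Polynomial.X * (1 - Polynomial.X)) -
        (1 - Polynomial.C (4 * S₁) * Polynomial.X * (1 - Polynomial.X))) ^ 2 with hQ
  have hQe : ∀ s : ℝ, Q.eval s = 4 * c ^ 2 * (1 - 4 * s * (1 - s) * S₀) -
      (c ^ 2 + (1 - 4 * s * (1 - s) * S₀) - (1 - 4 * s * (1 - s) * S₁)) ^ 2 := by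
    intro s
    simp only [hQ, Polynomial.eval_sub, Polynomial.eval_add, Polynomial.eval_mul, Polynomial.eval_C,
      Polynomial.eval_X, Polynomial.eval_pow, Polynomial.eval_one]
    ring
  have hQ0 : Q ≠ 0 := by
    intro h
    have h0 := hQe 0
    rw [h, Polynomial.eval_zero] at h0
    have : (4 : ℝ) * c ^ 2 * (1 - 4 * 0 * (1 - 0) * S₀) - (c ^ 2 + (1 - 4 * 0 * (1 - 0) * S₀) - (1 - 4 * 0 * (1 - 0) * S₁)) ^ 2 =
        c ^ 2 * (4 - c ^ 2) := by ring
    rw [this] at h0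
    have : 0 < c ^ 2 * (4 - c ^ 2) := mul_pos (by positivity) (by nlinarith)
    linarith
  refine (Polynomial.finite_setOf_isRoot hQ0).subset ?_
  rintro s ⟨hs, hcs⟩
  simp only [mem_setOf_eq, Polynomial.IsRoot.def, hQe]
  have hss : 0 ≤ 4 * s * (1 - s) ∧ 4 * s * (1 - s) ≤ 1 := by
    constructor <;> nlinarith [hs.1, hs.2, sq_nonneg (2 * s - 1)]
  have hR₀ : 0 ≤ 1 - 4 * s * (1 - s) * S₀ := by nlinarith
  have hR₁ : 0 ≤ 1 - 4 * s * (1 - s) * S₁ := by nlinarith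
  have hA₀sq : Real.sqrt (1 - 4 * s * (1 - s) * S₀) ^ 2 = 1 - 4 * s * (1 - s) * S₀ := Real.sq_sqrt hR₀
  have hA₁sq : Real.sqrt (1 - 4 * s * (1 - s) * S₁) ^ 2 = 1 - 4 * s * (1 - s) * S₁ := Real.sq_sqrt hR₁
  have H1 : c ^ 2 + (1 - 4 * s * (1 - s) * S₀) - (1 - 4 * s * (1 - s) * S₁) =
      2 * c * Real.sqrt (1 - 4 * s * (1 - s) * S₀) := by
    have hA1 : Real.sqrt (1 - 4 * s * (1 - s) * S₁) = c - Real.sqrt (1 - 4 * s * (1 - s) * S₀) := by linarith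
    have e : Real.sqrt (1 - 4 * s * (1 - s) * S₁) ^ 2 = (c - Real.sqrt (1 - 4 * s * (1 - s) * S₀)) ^ 2 := by rw [hA1]
    rw [hA₁sq] at e
    linear_combination (-1 : ℝ) * e + (-1 : ℝ) * hA₀sq
  linear_combination
    (-(c ^ 2 + (1 - 4 * s * (1 - s) * S₀) - (1 - 4 * s * (1 - s) * S₁) + 2 * c * Real.sqrt (1 - 4 * s * (1 - s) * S₀))) * H1 +
      (-(4 * c ^ 2)) * hA₀sq

/-- **The square-lattice Lindhard function as an explicit elliptic integral.** For `-4 < μ < 0` and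
`q ∉ 2πℤ²`:
`lindhardFunction ε₀ μ q = (2π)⁻² ∫₀¹ anisoDOSMass μ (A₀(s)) (A₁(s)) ds`, `A_i(s) = √(1 - 4s(1-s) sin²(q_i/2))`
(CERT-SREP Prop. 2 with (1.1)). [cite: RaghuKivelsonScalapino2010, §II (5)–(6)] -/
theorem lindhardFunction_squareDispersion_eq_integral_anisoDOSMass (μ : ℝ) (hμ : μ ∈ Ioo (-4 : ℝ) 0)
    (q : Momentum) (hq : ∃ i : Fin 2, ∀ n : ℤ, q i ≠ 2 * Real.pi * n) :
    lindhardFunction (squareDispersion 1 0) μ q =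
      (∫ s in (0 : ℝ)..1, anisoDOSMass μ (Real.sqrt (1 - 4 * s * (1 - s) * Real.sin (q 0 / 2) ^ 2))
        (Real.sqrt (1 - 4 * s * (1 - s) * Real.sin (q 1 / 2) ^ 2))) / (2 * Real.pi) ^ 2 := by
  rw [lindhardFunction_squareDispersion_eq_sRepresentation μ hμ q hq]
  congr 1
  obtain ⟨hμ4, hμ0⟩ := hμ
  set S₀ := Real.sin (q 0 / 2) ^ 2 with hS₀
  set S₁ := Real.sin (q 1 / 2) ^ 2 with hS₁
  have hS₀0 : 0 ≤ S₀ := sq_nonneg _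
  have hS₁0 : 0 ≤ S₁ := sq_nonneg _
  have hS₀1 : S₀ ≤ 1 := by rw [hS₀]; nlinarith [Real.sin_sq_le_one (q 0 / 2)]
  have hS₁1 : S₁ ≤ 1 := by rw [hS₁]; nlinarith [Real.sin_sq_le_one (q 1 / 2)]
  -- the exceptional parameters: a finite set
  set E : Set ℝ :=
    {s : ℝ | s ∈ Icc (0 : ℝ) 1 ∧ (μ = 2 * (Real.sqrt (1 - 4 * s * (1 - s) * S₀) - Real.sqrt (1 - 4 * s * (1 - s) * S₁)) ∨
       μ = 2 * (Real.sqrt (1 - 4 * s * (1 - s) * S₁) - Real.sqrt (1 - 4 * s * (1 - s) * S₀)))} ∪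
    {s : ℝ | s ∈ Icc (0 : ℝ) 1 ∧ -μ / 2 = Real.sqrt (1 - 4 * s * (1 - s) * S₀) + Real.sqrt (1 - 4 * s * (1 - s) * S₁)} ∪
    ({s : ℝ | 1 - 4 * s * (1 - s) * S₀ = 0} ∪ {s : ℝ | 1 - 4 * s * (1 - s) * S₁ = 0}) with hE
  have hEfin : E.Finite := by
    refine ((finite_setOf_vanHove μ S₀ S₁ hμ0.ne (by nlinarith) hS₀0 hS₀1 hS₁0 hS₁1).union
      (finite_setOf_bandEdge (-μ / 2) S₀ S₁ (by linarith) (by linarith) hS₀0 hS₀1 hS₁0 hS₁1)).union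
      ((finite_setOf_amplitude_zero S₀).union (finite_setOf_amplitude_zero S₁))
  have hae : ∀ᵐ s : ℝ, s ∉ E := measure_eq_zero_iff_ae_notMem.1 (hEfin.measure_zero volume)
  refine intervalIntegral.integral_congr_ae ?_
  filter_upwards [hae] with s hsE hsI
  rw [uIoc_of_le zero_le_one] at hsI
  have hs : s ∈ Icc (0 : ℝ) 1 := ⟨hsI.1.le, hsI.2⟩
  simp only [hE, mem_union, mem_setOf_eq, not_or] at hsE
  obtain ⟨⟨hvH, hedge⟩, hz₀, hz₁⟩ := hsE
  have hss : 0 ≤ 4 * s * (1 - s) ∧ 4 * s * (1 - s) ≤ 1 := by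
    constructor <;> nlinarith [hs.1, hs.2, sq_nonneg (2 * s - 1)]
  have hR₀ : 0 < 1 - 4 * s * (1 - s) * S₀ := lt_of_le_of_ne (by nlinarith) (Ne.symm hz₀)
  have hR₁ : 0 < 1 - 4 * s * (1 - s) * S₁ := lt_of_le_of_ne (by nlinarith) (Ne.symm hz₁)
  set A₀ := Real.sqrt (1 - 4 * s * (1 - s) * S₀) with hA₀
  set A₁ := Real.sqrt (1 - 4 * s * (1 - s) * S₁) with hA₁
  have hA₀pos : 0 < A₀ := Real.sqrt_pos.2 hR₀
  have hA₁pos : 0 < A₁ := Real.sqrt_pos.2 hR₁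
  have h₁ : |μ| ≠ 2 * |A₀ - A₁| := by
    intro h
    rw [abs_of_neg hμ0] at h
    apply hvH
    refine ⟨hs, ?_⟩
    rcases le_or_gt A₁ A₀ with hle | hgt
    · rw [abs_of_nonneg (sub_nonneg.2 hle)] at h
      exact Or.inr (by linarith)
    · rw [abs_of_neg (sub_neg.2 hgt)] at h
      exact Or.inl (by linarith)
  have h₂ : |μ| ≠ 2 * (A₀ + A₁) := by
    intro h; rw [abs_of_neg hμ0] at h; exact hedge ⟨hs, by linarith⟩
  exact fermiCurveMeasure_anisoBand_univ_toReal hA₀pos hA₁pos h₁ h₂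

end Literature.MathematicalPhysics.QuantumLattice
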